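import Summits.HubbardSuperconductivity.HubbardLadder.PairCorrSectorAssembly
import HarnessLib

/-!
# Rung R3 — LIST rows: windows on `Σᵢ λᵢ P̄_d(L, rᵢ)` from `pair_dd` LIST certificates, and the
# orbit-averaged dichotomy object at `L = 4` (companion of `PairCorrSectorAssembly`)

HONEST FRAMING (page 1): ladder R1–R4 with certified numbers; no claim on H/H₀. This file proves SOUNDNESS
EDGES, types two row objects and one obligation (proved: an implication from certificates nobody holds); no
certificate of the kind it consumes exists (no `pair_dd` instance has been run by anyone; result line (iii)
of record, verbatim: no R3 instance has been run; no dichotomy is certified at any size; there are no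
brackets to overlap).

WHY THIS FILE. The engines' `pair_dd` objective is a LIST `Σᵢ λᵢ V_{rᵢ}` (FORMAT-certsdp1 §9 addendum rev 3,
P-2), read here as `pairListObjective L λ r` (`PairCorrSectorRows` §3, `re_expect_pairListObjective`:
`Re ⟨ψ, X ψ⟩ = L² Σᵢ λᵢ P̄_d(L, rᵢ; ψ)`). A single-entry list (`λ = ±1`) certifies one displacement and feeds
`PairCorrWindowCert` (#116 §3, `PairCorrSectorAssembly` §7). But a producer that reduces by the POINT GROUP
(addendum P-3, `point_group: true`) may only certify D₄-invariant lists — for the instance `pairrows-N14`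
of R3-PAIRROWS-SPEC §7 the entries `(2,0) ⊕ (0,2)` and `(2,1) ⊕ (1,2)` with coefficients `1/2` — and the
certified quantity is then the orbit MEAN `½ (P̄_d(L,(2,0); ψ) + P̄_d(L,(0,2); ψ))` of EVERY ground-state
vector `ψ`, which is NOT a window on `P̄_d(L,(2,0); ψ)` alone when the ground level is degenerate (a
non-symmetric vector of the level need not have `P̄_d(2,0) = P̄_d(0,2)`; symmetry-identification rows are
never added to the consumer — R3-DESIGN §16). Such a certificate pair had NO typed consumer; this file is it:

* §8.1 `PairListWindowCert H N L λ r` — a certified window `[lo, hi]` on `Σᵢ λᵢ P̄_d(L, rᵢ; ψ)` over every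
  normalised ground state of `H L` in the sector `(N L, S^z = 0)`; transport along families agreeing at `L`;
  a single-entry list row with `λ = 1` IS a `PairCorrWindowCert` row (`toPairCorrWindowCert`).
* §8.2 `PairListWindowCert.ofSectorListCerts` — two LIST certificates with coefficient vectors `λ` (value
  `q₊`) and `−λ` (value `q₋`), same displacements, energy hypotheses dominating the sector ground energy,
  give the window `[q₊/(m+1)², −q₋/(m+1)²]`.
* §8.3 `FiniteListDichotomyCert H⁻ H⁺ N L λ r` (`a < b`, `|Σ λᵢ P̄_d(rᵢ)| ≤ a` on every sector ground state
  of `H⁻ L`, `b ≤ Σ λᵢ P̄_d(rᵢ)` on every one of `H⁺ L`), `separates`, `ofWindows`; a single-entry list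
  dichotomy with `λ = 1` IS the cell's `FiniteDichotomyCert` (`toFiniteDichotomyCert`).
* §8.4 the `L = 4` assembly `r3ListDichotomyFour_of_sectorListCerts` for
  `(pureHubbard 8, fun L => hubbardTorusTT' L 1 (-1/4) 8, electronNumber (1/8))` from four list
  certificates + the two typed upper claims + the test `max |q₊⁰| |q₋⁰| < q₊¹` (`a = max |q₊⁰/16| |−q₋⁰/16|`,
  `b = q₊¹/16`), and the typed obligation `PairDDListRowAssemblyFour` (PROVED). The result line for such a
  row must say "orbit-averaged" (brief (iii) wording: "certified: at L = 4, class [r], ½ Σ P̄_d ≤ a < b ≤ …"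
  or "brackets overlap: no dichotomy certified at this size").

Every hypothesis is a binder or a structure field; nothing about the Hubbard ground state is assumed; no
number is introduced.

## References
* J. Wang et al., *Certifying ground-state properties of many-body systems*, PRX 14 (2024) 031006,
  §3 eq. (obsopt). [cite: WangEtAl2024, §3 eq. (obsopt)]
* M. Qin et al., PRX 10 (2020) 031016, §II eqs. (2)–(4), §III.B. [cite: QinEtAl2020, §II eqs. (2)–(4)]
* H. Xu et al., Science 384 (2024) eadh7691, §II (the `t'/t ≈ −0.2` contrast). [cite: XuEtAl2024, §II]
* E. H. Lieb, PRL 62 (1989) 1201, proof of Thm 1 (`S^z = 0` representatives). [cite: LiebPRL1989]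
* Cell documents: `pub-hubbard-r3/R3-PAIRROWS-SPEC.md` §4, §5′, §7; `pub-hubbard-r3/R3-DESIGN.md` §16–§17;
  `run/shared/lean/engines/code/certsdp/docs/FORMAT-certsdp1-addendum-pairdd-draft.md` (rev 3) P-1–P-3.
-/

noncomputable section

namespace Summit.HubbardSuperconductivity.HubbardLadder

open Matrix Finset Literature.MathematicalPhysics.QuantumLattice Literature.Probability.LatticeModels
open scoped ComplexOrder

/-! ## §8.1 The LIST row object -/

/-- **R3 LIST row.** A certified two-sided window for the rational combination
`Σᵢ λᵢ P̄_d(L, rᵢ; ψ)` of translation-averaged `d`-wave pair correlators, valid for EVERY normalised ground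
state of `H L` in the sector `(N L, S^z = 0)` — the object a `pair_dd` LIST certificate pair certifies (for
`λ = (1/|S|, …, 1/|S|)` over a displacement class `S`: the class MEAN). [cite: QinEtAl2020, §II eqs. (2)–(4)] -/
structure PairListWindowCert (H : TorusHamiltonianFamily) (N : ℕ → ℕ) (L : ℕ) {n : ℕ}
    (lam : Fin n → ℝ) (r : Fin n → Site 2) where
  /-- certified lower end of the window -/
  lo : ℝ
  /-- certified upper end of the window -/
  hi : ℝ
  /-- soundness: every normalised sector ground state has the combination in the window -/
  sound : ∀ ψ : Fock (Orb (FermionTorus 2 L)), star ψ ⬝ᵥ ψ = 1 →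
    IsGroundStateInSector (H L) (N L) 0 ψ →
      lo ≤ ∑ i, lam i * avgPairCorr L (r i) ψ ∧ ∑ i, lam i * avgPairCorr L (r i) ψ ≤ hi

namespace PairListWindowCert

variable {H H' : TorusHamiltonianFamily} {N N' : ℕ → ℕ} {L n : ℕ} {lam : Fin n → ℝ} {r : Fin n → Site 2}

/-- Transport along families that agree at side `L` (same ends). [folklore] -/
def transport (w : PairListWindowCert H N L lam r) (hH : H' L = H L) (hN : N' L = N L) :
    PairListWindowCert H' N' L lam r where
  lo := w.lo
  hi := w.hi
  sound ψ h₁ h₂ := w.sound ψ h₁ (by rw [hH, hN] at h₂; exact h₂)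

/-- A single-entry list row with `λ = 1` is a `PairCorrWindowCert` row (same ends). [folklore] -/
def toPairCorrWindowCert {r₀ : Site 2}
    (w : PairListWindowCert H N L (fun _ : Fin 1 => (1 : ℝ)) fun _ => r₀) :
    PairCorrWindowCert H N L r₀ where
  lo := w.lo
  hi := w.hi
  sound ψ h₁ h₂ := by simpa using w.sound ψ h₁ h₂

end PairListWindowCert

/-! ## §8.2 LIST rows from two `pair_dd` LIST certificates -/

section ListTorus

variable {n : ℕ}

/-- **LIST row from two `pair_dd` LIST certificates** with coefficient vectors `λ` (value `q₊`) and `−λ`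
(value `q₋`), same displacements, same sector `(N (m+1), S^z = 0)`, energy hypotheses `u₊`, `u₋` each
dominating the sector ground energy: the window `[q₊/(m+1)², −q₋/(m+1)²]` on `Σᵢ λᵢ P̄_d(m+1, rᵢ; ψ)`
(`re_expect_pairListObjective`). HONEST FRAMING: ladder R1–R4 with certified numbers; no claim on H/H₀.
[cite: QinEtAl2020, §II eqs. (2)–(4)] -/
def PairListWindowCert.ofSectorListCerts (m : ℕ) (t t' U : ℝ) (N : ℕ → ℕ) (lam : Fin n → ℝ)
    (r : Fin n → Site 2) {up um qp qm : ℝ}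
    (Cp : TorusSectorObsCertTT' (m + 1) t t' U (N (m + 1)) 0 up (pairListObjective (m + 1) lam r) qp)
    (Cm : TorusSectorObsCertTT' (m + 1) t t' U (N (m + 1)) 0 um
      (pairListObjective (m + 1) (fun i => -lam i) r) qm)
    (hEp : (hubbardTorusTT' (m + 1) t t' U).minEnergyOn (szSector (N (m + 1)) 0) ≤ up)
    (hEm : (hubbardTorusTT' (m + 1) t t' U).minEnergyOn (szSector (N (m + 1)) 0) ≤ um) :
    PairListWindowCert (fun L => hubbardTorusTT' L t t' U) N (m + 1) lam r where
  lo := qp / ((m + 1 : ℕ) : ℝ) ^ 2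
  hi := -qm / ((m + 1 : ℕ) : ℝ) ^ 2
  sound ψ h₁ hgs := by
    have hL2 : (0 : ℝ) < ((m + 1 : ℕ) : ℝ) ^ 2 := by positivity
    have hp := Cp.re_expect_ge hEp ψ h₁ hgs
    have hm := Cm.re_expect_ge hEm ψ h₁ hgs
    rw [re_expect_pairListObjective] at hp hm
    have hneg : ∑ i, -lam i * avgPairCorr (m + 1) (r i) ψ = -∑ i, lam i * avgPairCorr (m + 1) (r i) ψ := by
      rw [← Finset.sum_neg_distrib]
      exact Finset.sum_congr rfl fun i _ => by ring
    rw [hneg] at hm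
    constructor
    · rw [div_le_iff₀ hL2]; linarith
    · rw [le_div_iff₀ hL2]; linarith

/-- Its window, for the record: `[q₊/(m+1)², −q₋/(m+1)²]`. [folklore] -/
theorem PairListWindowCert.ofSectorListCerts_lo_hi (m : ℕ) (t t' U : ℝ) (N : ℕ → ℕ) (lam : Fin n → ℝ)
    (r : Fin n → Site 2) {up um qp qm : ℝ}
    (Cp : TorusSectorObsCertTT' (m + 1) t t' U (N (m + 1)) 0 up (pairListObjective (m + 1) lam r) qp)
    (Cm : TorusSectorObsCertTT' (m + 1) t t' U (N (m + 1)) 0 um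
      (pairListObjective (m + 1) (fun i => -lam i) r) qm)
    (hEp : (hubbardTorusTT' (m + 1) t t' U).minEnergyOn (szSector (N (m + 1)) 0) ≤ up)
    (hEm : (hubbardTorusTT' (m + 1) t t' U).minEnergyOn (szSector (N (m + 1)) 0) ≤ um) :
    (PairListWindowCert.ofSectorListCerts m t t' U N lam r Cp Cm hEp hEm).lo = qp / ((m + 1 : ℕ) : ℝ) ^ 2 ∧
      (PairListWindowCert.ofSectorListCerts m t t' U N lam r Cp Cm hEp hEm).hi =
        -qm / ((m + 1 : ℕ) : ℝ) ^ 2 :=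
  ⟨rfl, rfl⟩

/-! ## §8.3 The LIST dichotomy object -/

/-- **R3 LIST dichotomy at `(L, λ, r)`.** Certified numbers `a < b` with `|Σᵢ λᵢ P̄_d(L, rᵢ; ψ)| ≤ a` for
every normalised sector ground state `ψ` of `H⁻ L` and `b ≤ Σᵢ λᵢ P̄_d(L, rᵢ; ψ)` for every normalised sector
ground state of `H⁺ L` (for a class mean: an ORBIT-AVERAGED finite dichotomy). [cite: QinEtAl2020, §III.B]
[cite: XuEtAl2024, §II] -/
structure FiniteListDichotomyCert (Hneg Hpos : TorusHamiltonianFamily) (N : ℕ → ℕ) (L : ℕ)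
    (lam : Fin n → ℝ) (r : Fin n → Site 2) where
  /-- certified ceiling of `|Σᵢ λᵢ P̄_d(rᵢ)|` on the disordered side -/
  a : ℝ
  /-- certified floor of `Σᵢ λᵢ P̄_d(rᵢ)` on the ordered side -/
  b : ℝ
  a_lt_b : a < b
  abs_le_of_neg : ∀ ψ : Fock (Orb (FermionTorus 2 L)), star ψ ⬝ᵥ ψ = 1 →
    IsGroundStateInSector (Hneg L) (N L) 0 ψ → |∑ i, lam i * avgPairCorr L (r i) ψ| ≤ a
  le_of_pos : ∀ ψ : Fock (Orb (FermionTorus 2 L)), star ψ ⬝ᵥ ψ = 1 →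
    IsGroundStateInSector (Hpos L) (N L) 0 ψ → b ≤ ∑ i, lam i * avgPairCorr L (r i) ψ

namespace FiniteListDichotomyCert

variable {Hneg Hpos : TorusHamiltonianFamily} {N : ℕ → ℕ} {L : ℕ} {lam : Fin n → ℝ} {r : Fin n → Site 2}

/-- A list dichotomy separates the two ground-state manifolds by the value of one combination. [folklore] -/
theorem separates (cert : FiniteListDichotomyCert Hneg Hpos N L lam r)
    {ψneg ψpos : Fock (Orb (FermionTorus 2 L))}
    (hneg₁ : star ψneg ⬝ᵥ ψneg = 1) (hneg₂ : IsGroundStateInSector (Hneg L) (N L) 0 ψneg)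
    (hpos₁ : star ψpos ⬝ᵥ ψpos = 1) (hpos₂ : IsGroundStateInSector (Hpos L) (N L) 0 ψpos) :
    ∑ i, lam i * avgPairCorr L (r i) ψneg < ∑ i, lam i * avgPairCorr L (r i) ψpos :=
  ((le_abs_self _).trans (cert.abs_le_of_neg ψneg hneg₁ hneg₂)).trans_lt
    (cert.a_lt_b.trans_le (cert.le_of_pos ψpos hpos₁ hpos₂))

/-- Assembly from two list windows that do not overlap, `max(|lo⁻|, |hi⁻|) < lo⁺`. [folklore] -/
def ofWindows (wneg : PairListWindowCert Hneg N L lam r) (wpos : PairListWindowCert Hpos N L lam r)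
    (h : max |wneg.lo| |wneg.hi| < wpos.lo) : FiniteListDichotomyCert Hneg Hpos N L lam r where
  a := max |wneg.lo| |wneg.hi|
  b := wpos.lo
  a_lt_b := h
  abs_le_of_neg ψ h₁ h₂ := by
    obtain ⟨hlo, hhi⟩ := wneg.sound ψ h₁ h₂
    exact abs_le_max_abs_abs hlo hhi
  le_of_pos ψ h₁ h₂ := (wpos.sound ψ h₁ h₂).1

end FiniteListDichotomyCert

/-- A single-entry list dichotomy with `λ = 1` IS the cell's `FiniteDichotomyCert` at that displacement
(same levels). [folklore] -/
def FiniteListDichotomyCert.toFiniteDichotomyCert {Hneg Hpos : TorusHamiltonianFamily} {N : ℕ → ℕ}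
    {L : ℕ} {r₀ : Site 2}
    (c : FiniteListDichotomyCert Hneg Hpos N L (fun _ : Fin 1 => (1 : ℝ)) fun _ => r₀) :
    FiniteDichotomyCert Hneg Hpos N L r₀ where
  a := c.a
  b := c.b
  a_lt_b := c.a_lt_b
  abs_le_of_neg ψ h₁ h₂ := by simpa using c.abs_le_of_neg ψ h₁ h₂
  le_of_pos ψ h₁ h₂ := by simpa using c.le_of_pos ψ h₁ h₂

/-! ## §8.4 The `L = 4` assembly from four LIST certificates -/

/-- **R3 LIST dichotomy at `L = 4` from `pair_dd` LIST certificates** (the orbit-averaged entries of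
`pairrows-N14`). Four list certificates with coefficient vectors `λ` / `−λ` at the same displacements —
`t' = 0` values `q₊⁰, q₋⁰` at hypothesis `u₀`, `t' = −1/4` values `q₊¹, q₋¹` at `u₁` — the two typed upper
claims and `max |q₊⁰| |q₋⁰| < q₊¹` give
`FiniteListDichotomyCert (pureHubbard 8) (fun L => hubbardTorusTT' L 1 (-1/4) 8) (electronNumber (1/8)) 4 λ r`
with `a = max |q₊⁰/16| |−q₋⁰/16|`, `b = q₊¹/16`. NOTHING RUN. HONEST FRAMING: ladder R1–R4 with certified
numbers; no claim on H/H₀. [cite: QinEtAl2020, §III.B] [cite: XuEtAl2024, §II] -/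
def r3ListDichotomyFour_of_sectorListCerts (lam : Fin n → ℝ) (r : Fin n → Site 2)
    {u₀ u₁ qp₀ qm₀ qp₁ qm₁ : ℝ}
    (Cp₀ : TorusSectorObsCertTT' 4 1 0 8 14 0 u₀ (pairListObjective 4 lam r) qp₀)
    (Cm₀ : TorusSectorObsCertTT' 4 1 0 8 14 0 u₀ (pairListObjective 4 (fun i => -lam i) r) qm₀)
    (hup₀ : groundEnergyAt (fermionTorusGraph 2 4) 1 8 14 ≤ u₀)
    (Cp₁ : TorusSectorObsCertTT' 4 1 ((-1 : ℝ) / 4) 8 14 0 u₁ (pairListObjective 4 lam r) qp₁)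
    (Cm₁ : TorusSectorObsCertTT' 4 1 ((-1 : ℝ) / 4) 8 14 0 u₁ (pairListObjective 4 (fun i => -lam i) r) qm₁)
    (hup₁ : groundEnergy (hubbardRectTorusTT' 4 4 1 ((-1 : ℝ) / 4) 8) 14 ≤ u₁)
    (h : max |qp₀| |qm₀| < qp₁) :
    FiniteListDichotomyCert (pureHubbard 8) (fun L => hubbardTorusTT' L 1 (-1 / 4) 8)
      (electronNumber (1 / 8)) 4 lam r :=
  have hE₀ : (hubbardTorusTT' 4 1 0 8).minEnergyOn (szSector 14 0) ≤ u₀ :=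
    minEnergyOn_szSector_zero_le_of_groundEnergyAt_le (L := 4) 1 8 (nh := 7)
      seven_le_card_fermionTorus_four hup₀
  have hE₁ : (hubbardTorusTT' 4 1 ((-1 : ℝ) / 4) 8).minEnergyOn (szSector 14 0) ≤ u₁ :=
    minEnergyOn_szSector_le_of_groundEnergy_rect_le (L := 4) 1 ((-1 : ℝ) / 4) 8 (nh := 7)
      seven_le_card_fermionTorus_four hup₁
  FiniteListDichotomyCert.ofWindows
    ((PairListWindowCert.ofSectorListCerts 3 1 0 8 (fun _ => 14) lam r Cp₀ Cm₀ hE₀ hE₀).transport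
      pureHubbard_eight_four electronNumber_eighth_four)
    ((PairListWindowCert.ofSectorListCerts 3 1 ((-1 : ℝ) / 4) 8 (fun _ => 14) lam r Cp₁ Cm₁ hE₁ hE₁).transport
      rfl electronNumber_eighth_four)
    (by
      show max |qp₀ / ((3 + 1 : ℕ) : ℝ) ^ 2| |-qm₀ / ((3 + 1 : ℕ) : ℝ) ^ 2| < qp₁ / ((3 + 1 : ℕ) : ℝ) ^ 2
      norm_num only [Nat.cast_ofNat]
      exact max_abs_div_sixteen_lt h)

/-- Its levels, for the record: `a = max |q₊⁰/16| |−q₋⁰/16|`, `b = q₊¹/16`. [folklore] -/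
theorem r3ListDichotomyFour_of_sectorListCerts_a_b (lam : Fin n → ℝ) (r : Fin n → Site 2)
    {u₀ u₁ qp₀ qm₀ qp₁ qm₁ : ℝ}
    (Cp₀ : TorusSectorObsCertTT' 4 1 0 8 14 0 u₀ (pairListObjective 4 lam r) qp₀)
    (Cm₀ : TorusSectorObsCertTT' 4 1 0 8 14 0 u₀ (pairListObjective 4 (fun i => -lam i) r) qm₀)
    (hup₀ : groundEnergyAt (fermionTorusGraph 2 4) 1 8 14 ≤ u₀)
    (Cp₁ : TorusSectorObsCertTT' 4 1 ((-1 : ℝ) / 4) 8 14 0 u₁ (pairListObjective 4 lam r) qp₁)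
    (Cm₁ : TorusSectorObsCertTT' 4 1 ((-1 : ℝ) / 4) 8 14 0 u₁ (pairListObjective 4 (fun i => -lam i) r) qm₁)
    (hup₁ : groundEnergy (hubbardRectTorusTT' 4 4 1 ((-1 : ℝ) / 4) 8) 14 ≤ u₁)
    (h : max |qp₀| |qm₀| < qp₁) :
    (r3ListDichotomyFour_of_sectorListCerts lam r Cp₀ Cm₀ hup₀ Cp₁ Cm₁ hup₁ h).a =
        max |qp₀ / 16| |-qm₀ / 16| ∧
      (r3ListDichotomyFour_of_sectorListCerts lam r Cp₀ Cm₀ hup₀ Cp₁ Cm₁ hup₁ h).b = qp₁ / 16 := by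
  constructor
  · show max |qp₀ / ((3 + 1 : ℕ) : ℝ) ^ 2| |-qm₀ / ((3 + 1 : ℕ) : ℝ) ^ 2| = _; norm_num
  · show qp₁ / ((3 + 1 : ℕ) : ℝ) ^ 2 = _; norm_num

/-- **Typed obligation (assembly of an ORBIT-AVERAGED R3 row at `L = 4` from `pair_dd` LIST
certificates)**: for every coefficient vector `λ` and displacement list `r`, four list certificates as in
`r3ListDichotomyFour_of_sectorListCerts`, the two typed upper energy claims and `max |q₊⁰| |q₋⁰| < q₊¹`
yield the list dichotomy object at `(4, λ, r)` with `a = max |q₊⁰/16| |−q₋⁰/16|`, `b = q₊¹/16`. PROVED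
(`pairDDListRowAssemblyFour_holds`); NO such certificate exists (nothing has been run). HONEST FRAMING:
ladder R1–R4 with certified numbers; no claim on H/H₀. -/
@[conjecture] def PairDDListRowAssemblyFour : Prop :=
  ∀ (n : ℕ) (lam : Fin n → ℝ) (r : Fin n → Site 2) (u₀ u₁ qp₀ qm₀ qp₁ qm₁ : ℝ),
    Nonempty (TorusSectorObsCertTT' 4 1 0 8 14 0 u₀ (pairListObjective 4 lam r) qp₀) →
    Nonempty (TorusSectorObsCertTT' 4 1 0 8 14 0 u₀ (pairListObjective 4 (fun i => -lam i) r) qm₀) →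
    groundEnergyAt (fermionTorusGraph 2 4) 1 8 14 ≤ u₀ →
    Nonempty (TorusSectorObsCertTT' 4 1 ((-1 : ℝ) / 4) 8 14 0 u₁ (pairListObjective 4 lam r) qp₁) →
    Nonempty (TorusSectorObsCertTT' 4 1 ((-1 : ℝ) / 4) 8 14 0 u₁
      (pairListObjective 4 (fun i => -lam i) r) qm₁) →
    groundEnergy (hubbardRectTorusTT' 4 4 1 ((-1 : ℝ) / 4) 8) 14 ≤ u₁ →
    max |qp₀| |qm₀| < qp₁ →
      ∃ c : FiniteListDichotomyCert (pureHubbard 8) (fun L => hubbardTorusTT' L 1 (-1 / 4) 8)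
          (electronNumber (1 / 8)) 4 lam r,
        c.a = max |qp₀ / 16| |-qm₀ / 16| ∧ c.b = qp₁ / 16

/-- **Proof of `PairDDListRowAssemblyFour`.** -/
theorem pairDDListRowAssemblyFour_holds : PairDDListRowAssemblyFour := by
  rintro n lam r u₀ u₁ qp₀ qm₀ qp₁ qm₁ ⟨Cp₀⟩ ⟨Cm₀⟩ hup₀ ⟨Cp₁⟩ ⟨Cm₁⟩ hup₁ h
  exact ⟨r3ListDichotomyFour_of_sectorListCerts lam r Cp₀ Cm₀ hup₀ Cp₁ Cm₁ hup₁ h,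
    r3ListDichotomyFour_of_sectorListCerts_a_b lam r Cp₀ Cm₀ hup₀ Cp₁ Cm₁ hup₁ h⟩

end ListTorus

end Summit.HubbardSuperconductivity.HubbardLadder
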